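import Summits.QuantumFields.YangMills.Theorems.LuscherReductionDressedRitzPolyakovLiftTransplantAERadius
import Summits.QuantumFields.YangMills.Theorems.LuscherReductionDressedRitzPolyakovLiftClusterConcentration
import Summits.QuantumFields.YangMills.Theorems.LuscherReductionDressedRitzPolyakovLiftShadowVectorTransfer
import Summits.QuantumFields.YangMills.Theorems.LuscherReductionDressedRitzPolyakovLiftPScalingFamily
import Summits.QuantumFields.YangMills.Theorems.LuscherReductionDressedRitzPolyakovLiftShadowPositivity
import HarnessLib

/-!
# Route `LuscherReduction`, item `DressedRitz` (stmt-QuantumFields-20205), line «polyakovlift» r7, stub S-PSCAL″ — THE SHADOW VECTORS ARE WINDOW-CONCENTRATED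
# (F9 layers D2+D3, the one-site analytic half of the assembly; LEAD prover ym-lead-20205-polyakovlift g2)

One-site lattice (`Cfg`), coupling `B`.  INPUT: the adapted frame `e_k` with its exact top eigenfunction `e0 ⊥ e_k (k ≥ 1)` and the level-one domination
(tree `SpecSum.exists_spectral_eigenseq` + `PScal.rawVacuum_eq_smul`, taken as hypotheses); an AL1 family `F_0,…,F_K` up to a CLUSTER END `K ≥ k` with `F_0 > 0`;
the explicit quasimodes `Ψ_j = (χ_{ρ_j} F_j) ∘ gnCoord μ` (`μ = Λ/(2L)`, `ρ_0 = R_v` the vacuum radius, `ρ_j = R` else, `√2R ≤ R_v`, `√2R_vΛ < π`) with their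
first moments `θ_j‖Ψ_j‖² ≤ ⟨Ψ_j,KΨ_j⟩` and near-orthogonality (F6, tree `TransplantForms.oneSite_package`), the window/gap data of the levels in the currency of
`ClusterConc.cluster_concentration_in`, a sup bound `C_f` for the transplanted observables, and three scalar smallness conditions.
OUTPUT (★★ `shadowVectors_concentrated`): the shadow vectors `v_i = ins_{e0}(g_i ∘ powLink L)`, `g_i = transplantObsL L Λ R f i` (`f` = first `k+1` members of `F`),
are physical and WINDOW-CONCENTRATED in norm currency: `‖v_i‖² ≤ (1+ϑ)·Σ_{winLo(i+1) ≤ m < winHi(i+1)} ⟨v_i, e_m⟩²`, with positive window mass — the per-vector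
input of `PScal.dressed_clauses_of_concentration`.  Chain: cluster concentration of the `Ψ_j` (w1a), vacuum split `Φ̂₀ = a e0 + η` (`top_split_phys`), the
a.e. main-term identity `(g_i∘p_L)·Φ̂₀ = Ψ_{i+1}` (`shadowObs_mul_ground_ae_of_radius`), and `PScal.concentration_transfer`.

HONEST FRAMING: fixed-lattice one-site bookkeeping (conditional femto rung R2b1); nothing here bears on infinite volume, the continuum limit or the Clay gap.
References: Reed–Simon IV, Thm. XIII.1 [cite: ReedSimonIV1978, Thm. XIII.1]; M. Lüscher, NPB 219 (1983) 233 [cite: Luscher1983, §2–§3].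
-/

set_option autoImplicit false

noncomputable section

open MeasureTheory Filter Topology Real Finset
open Literature.MathematicalPhysics.QuantumFieldTheory (GaugeConfig Site gaugeTransform)
open Literature.Analysis.OperatorTheory.YMMatrixModel
open scoped BigOperators

namespace Summit.QuantumFields.YangMills.Theorems.FemtoTransferGap.PScal

open Summit.QuantumFields.YangMills.Theorems.FemtoTransferGap
open Summit.QuantumFields.YangMills.Theorems.FemtoTransferGap.PolyakovLift
open Summit.QuantumFields.YangMills.Theorems.FemtoTransferGap.ClusterInd (clusterDelta clusterDelta_nonneg)
open Summit.QuantumFields.YangMills.Theorems.FemtoTransferGap.ClusterConc (cluster_concentration_in firstMoment_split)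

variable {K k : ℕ}

/-- ★★ **The shadow vectors are window-concentrated.**  See the module docstring. [cite: ReedSimonIV1978, Thm. XIII.1] [cite: Luscher1983, §2–§3] -/
theorem shadowVectors_concentrated {B : ℝ} (hanti : Antitone fun j => levelValue su2Rep 1 B j)
    (e : ℕ → physSubmodule 1)
    (hon : ∀ i l, l2 ((e i : physSubmodule 1) : Cfg → ℝ) (e l) = if i = l then 1 else 0)
    (heig : ∀ j, transferApply B ((e j : physSubmodule 1) : Cfg → ℝ) = levelValue su2Rep 1 B j • ((e j : physSubmodule 1) : Cfg → ℝ))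
    (hdom : ∀ (j : ℕ) (ψ : Cfg → ℝ), IsPhys ψ → (∀ i, i < j → l2 ψ ((e i : physSubmodule 1) : Cfg → ℝ) = 0) →
      qform su2Rep B ψ ψ ≤ levelValue su2Rep 1 B j * l2 ψ ψ)
    {e0 : Cfg → ℝ} (he0 : IsPhys e0) (hn0 : l2 e0 e0 = 1) (heig0 : transferApply B e0 = levelValue su2Rep 1 B 0 • e0)
    (horth0 : ∀ m, 1 ≤ m → l2 e0 ((e m : physSubmodule 1) : Cfg → ℝ) = 0)
    (hdom1 : ∀ ψ : Cfg → ℝ, IsPhys ψ → l2 ψ e0 = 0 → qform su2Rep B ψ ψ ≤ levelValue su2Rep 1 B 1 * l2 ψ ψ)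
    -- the family up to a cluster end, radii, chart
    (hkK : k ≤ K) (hK : idxLevel K < idxLevel (K + 1)) {F : Fin (K + 1) → ZM → ℝ} (hF : IsEigenFamily K F) (hFpos : ∀ x, 0 < F 0 x)
    {Λ R Rv : ℝ} {L : ℕ} (hΛ : 0 < Λ) (hL : 0 < L) (hR : 0 < R) (hRRv : Real.sqrt 2 * R ≤ Rv) (hRvΛ : Real.sqrt 2 * Rv * Λ < π)
    (Ψ : Fin (K + 1) → Cfg → ℝ)
    (hΨ0 : Ψ 0 = fun U => radialCutoff Rv (gnCoord (Λ / (2 * L)) U) * F 0 (gnCoord (Λ / (2 * L)) U))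
    (hΨsucc : ∀ j : Fin (K + 1), 1 ≤ (j : ℕ) → Ψ j = fun U => radialCutoff R (gnCoord (Λ / (2 * L)) U) * F j (gnCoord (Λ / (2 * L)) U))
    (hΨphys : ∀ j, IsPhys (Ψ j)) (hΨpos : ∀ j, 0 < l2 (Ψ j) (Ψ j))
    {θ : Fin (K + 1) → ℝ} (hθ : ∀ j, θ j * l2 (Ψ j) (Ψ j) ≤ qform su2Rep B (Ψ j) (Ψ j))
    {ε s κ : ℝ} (hε : 0 ≤ ε) (hs : 0 ≤ s) (hκ : 0 ≤ κ)
    (hgram : ∀ j j' : Fin (K + 1), j ≠ j' → |l2 (Ψ j) (Ψ j')| ≤ ε * Real.sqrt (l2 (Ψ j) (Ψ j)) * Real.sqrt (l2 (Ψ j') (Ψ j')))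
    (hgap : ∀ j : Fin (K + 1), 0 < levelValue su2Rep 1 B (winLo j) - levelValue su2Rep 1 B (winHi j))
    (hsj : ∀ j : Fin (K + 1), levelValue su2Rep 1 B (winLo j) - θ j ≤ s * (levelValue su2Rep 1 B (winLo j) - levelValue su2Rep 1 B (winHi j)))
    (hκj : ∀ j : Fin (K + 1), levelValue su2Rep 1 B 0 - levelValue su2Rep 1 B (winLo j) ≤
      κ * (levelValue su2Rep 1 B (winLo j) - levelValue su2Rep 1 B (winHi j)))
    (hsmall : ((K + 1 : ℕ) : ℝ) * (ε + clusterDelta (K + 1) κ ε s (K + 1)) ≤ 1 / 2)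
    (hθ0 : levelValue su2Rep 1 B 1 < θ 0)
    {Cf : ℝ} (hCf0 : 0 ≤ Cf) (hCf : ∀ (i : Fin k) (y : ZM), |transplantFn R (fun j => F (Fin.castLE (Nat.succ_le_succ hkK) j)) i y| ≤ Cf)
    {ϑ : ℝ} (hϑ0 : 0 ≤ ϑ) (hϑ1 : ϑ ≤ 1 / 4) (hδ : clusterDelta (K + 1) κ ε s (K + 1) ≤ ϑ / 4)
    (hηsmall : ∀ i : Fin k, Cf ^ 2 * ((levelValue su2Rep 1 B 0 - θ 0) / (θ 0 - levelValue su2Rep 1 B 1) * l2 (Ψ 0) (Ψ 0)) ≤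
      (ϑ / 8) ^ 2 * l2 (Ψ ⟨(i : ℕ) + 1, by omega⟩) (Ψ ⟨(i : ℕ) + 1, by omega⟩))
    (i : Fin k) :
    IsPhys (OpPlat.ins e0 (transplantObsL L Λ R (fun j => F (Fin.castLE (Nat.succ_le_succ hkK) j)) i ∘ powLink L)) ∧
    l2 (OpPlat.ins e0 (transplantObsL L Λ R (fun j => F (Fin.castLE (Nat.succ_le_succ hkK) j)) i ∘ powLink L))
        (OpPlat.ins e0 (transplantObsL L Λ R (fun j => F (Fin.castLE (Nat.succ_le_succ hkK) j)) i ∘ powLink L)) ≤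
      (1 + ϑ) * ∑ m ∈ Ico (winLo ((i : ℕ) + 1)) (winHi ((i : ℕ) + 1)),
        l2 (OpPlat.ins e0 (transplantObsL L Λ R (fun j => F (Fin.castLE (Nat.succ_le_succ hkK) j)) i ∘ powLink L))
          ((e m : physSubmodule 1) : Cfg → ℝ) ^ 2 ∧
    0 < ∑ m ∈ Ico (winLo ((i : ℕ) + 1)) (winHi ((i : ℕ) + 1)),
        l2 (OpPlat.ins e0 (transplantObsL L Λ R (fun j => F (Fin.castLE (Nat.succ_le_succ hkK) j)) i ∘ powLink L))
          ((e m : physSubmodule 1) : Cfg → ℝ) ^ 2 := by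
  -- names
  set f : Fin (k + 1) → ZM → ℝ := fun j => F (Fin.castLE (Nat.succ_le_succ hkK) j) with hfdef
  set fsh : Cfg → ℝ := transplantObsL L Λ R f i ∘ powLink L with hfsh
  set jj : Fin (K + 1) := ⟨(i : ℕ) + 1, by omega⟩ with hjj
  set lam : ℕ → ℝ := fun j => levelValue su2Rep 1 B j with hlam
  have hf : IsEigenFamily k f := isEigenFamily_castLE hkK hF
  have hfpos : ∀ x, 0 < f 0 x := hFpos
  -- physicality of the shadow observable and of `v`
  obtain ⟨hm, hb, hinv⟩ := transplantFn_props hR hf hfpos i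
  have hgphys : IsPhys (transplantObsL L Λ R f i) := isPhys_rootPullback hm hb hinv L (Λ / 2)
  have hfshphys : IsPhys fsh := isPhys_comp_powLink L hgphys
  have hvphys : IsPhys (OpPlat.ins e0 fsh) := OpPlat.isPhys_ins he0 hfshphys
  refine ⟨hvphys, ?_⟩
  -- sup bound of the shadow observable
  have hfshCf : ∀ U, |fsh U| ≤ Cf := fun U => by
    simp only [hfsh, Function.comp, transplantObsL]; exact hCf i _
  -- the a.e. main-term identity `fsh · Φ̂₀ = Ψ_{i+1}`
  have hjj1 : 1 ≤ (jj : ℕ) := by simp [hjj]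
  have hprod : fsh * Ψ 0 =ᵐ[configMeasure SU2 1] Ψ jj := by
    have h := shadowObs_mul_ground_ae_of_radius hΛ hR hRRv hRvΛ hL f hfpos i
    have e1 : (fun U : Cfg => transplantObsL L Λ R f i (powLink L U) *
        (radialCutoff Rv (gnCoord (Λ / (2 * L)) U) * f 0 (gnCoord (Λ / (2 * L)) U))) = fsh * Ψ 0 := by
      rw [hΨ0]; funext U; simp only [hfsh, Pi.mul_apply, Function.comp]; rfl
    have e2 : (fun U : Cfg => radialCutoff R (gnCoord (Λ / (2 * L)) U) * f i.succ (gnCoord (Λ / (2 * L)) U)) = Ψ jj := by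
      rw [hΨsucc jj hjj1]
      funext U
      have : f i.succ = F jj := by
        simp only [hfdef, hjj]; congr 1
      rw [this]
    rw [e1, e2] at h
    exact h
  -- cluster concentration of `Ψ_{i+1}`
  have hconc := cluster_concentration_in (L := 1) e hon heig hdom hanti Ψ hΨphys hΨpos (fun j => winLo j) (winLo_mono_fin (K + 1))
    (fun j => winLo j) (fun j => winHi j) (fun j => card_filter_winLo_lt j) (fun j => card_filter_winLo_le hK j) hκ hε hs hgram θ hθ
    hgap hsj hκj hsmall jj
  obtain ⟨hinΨ, -, hBesΨle⟩ := hconc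
  -- window facts
  have hw := window_bounds hK jj
  have hw1 : 1 ≤ winLo ((i : ℕ) + 1) := hw.2.2.2 hjj1
  -- vacuum split `Ψ 0 = a e0 + η`
  have hθ0le : θ 0 ≤ lam 0 := by
    have h1 : θ 0 * l2 (Ψ 0) (Ψ 0) ≤ qform su2Rep B (Ψ 0) (Ψ 0) := hθ 0
    have h2 : qform su2Rep B (Ψ 0) (Ψ 0) ≤ lam 0 * l2 (Ψ 0) (Ψ 0) := hdom 0 (Ψ 0) (hΨphys 0) (fun i hi => absurd hi (Nat.not_lt_zero _))
    exact le_of_mul_le_mul_right (h1.trans h2) (hΨpos 0)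
  obtain ⟨-, hnormsplit, -, hηle, -, -⟩ := top_split_phys B (hΨphys 0) he0 hn0 heig0 hdom1 (hθ 0)
  have hgap1 : 0 < θ 0 - lam 1 := sub_pos.2 hθ0
  have hηnn : 0 ≤ l2 (Ψ 0 - l2 (Ψ 0) e0 • e0) (Ψ 0 - l2 (Ψ 0) e0 • e0) := l2_self_nonneg _
  have ha2le : l2 (Ψ 0) e0 ^ 2 ≤ l2 (Ψ 0) (Ψ 0) := by rw [hnormsplit]; linarith
  have hcoef0 : 0 ≤ (lam 0 - θ 0) / (θ 0 - lam 1) := div_nonneg (sub_nonneg.2 hθ0le) hgap1.le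
  have hη1 : l2 (Ψ 0 - l2 (Ψ 0) e0 • e0) (Ψ 0 - l2 (Ψ 0) e0 • e0) ≤ (lam 0 - θ 0) * l2 (Ψ 0) e0 ^ 2 / (θ 0 - lam 1) := by
    rw [le_div_iff₀ hgap1]; linarith [hηle]
  have hηbound : l2 (Ψ 0 - l2 (Ψ 0) e0 • e0) (Ψ 0 - l2 (Ψ 0) e0 • e0) ≤ (lam 0 - θ 0) / (θ 0 - lam 1) * l2 (Ψ 0) (Ψ 0) := by
    have h2 : (lam 0 - θ 0) * l2 (Ψ 0) e0 ^ 2 / (θ 0 - lam 1) = (lam 0 - θ 0) / (θ 0 - lam 1) * l2 (Ψ 0) e0 ^ 2 := by ring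
    rw [h2] at hη1
    exact hη1.trans (mul_le_mul_of_nonneg_left ha2le hcoef0)
  have ha : l2 (Ψ 0) e0 ≠ 0 := by
    intro ha0
    rw [ha0] at hη1 hnormsplit
    simp only [ne_eq, OfNat.ofNat_ne_zero, not_false_eq_true, zero_pow, mul_zero, zero_div, zero_add, zero_smul, sub_zero] at hη1 hnormsplit
    have := hΨpos 0
    linarith
  -- the window and its Bessel sums
  have hSsub : Ico (winLo ((i : ℕ) + 1)) (winHi ((i : ℕ) + 1)) ⊆ range (winHi ((i : ℕ) + 1)) := fun m hm => mem_range.2 (mem_Ico.1 hm).2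
  have heS : ∀ m ∈ Ico (winLo ((i : ℕ) + 1)) (winHi ((i : ℕ) + 1)), IsPhys ((e m : physSubmodule 1) : Cfg → ℝ) := fun m _ => (e m).2
  have horthS : ∀ m ∈ Ico (winLo ((i : ℕ) + 1)) (winHi ((i : ℕ) + 1)), l2 e0 ((e m : physSubmodule 1) : Cfg → ℝ) = 0 :=
    fun m hm => horth0 m (hw1.trans (mem_Ico.1 hm).1)
  have hηphys : IsPhys (Ψ 0 - l2 (Ψ 0) e0 • e0) := ((⟨Ψ 0, hΨphys 0⟩ : physSubmodule 1) - l2 (Ψ 0) e0 • (⟨e0, he0⟩ : physSubmodule 1)).2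
  have hfηphys : IsPhys (fsh * (Ψ 0 - l2 (Ψ 0) e0 • e0)) := OpPlat.isPhys_mul hfshphys hηphys
  have hBesselη : ∑ m ∈ Ico (winLo ((i : ℕ) + 1)) (winHi ((i : ℕ) + 1)), l2 (fsh * (Ψ 0 - l2 (Ψ 0) e0 • e0)) ((e m : physSubmodule 1) : Cfg → ℝ) ^ 2 ≤
      l2 (fsh * (Ψ 0 - l2 (Ψ 0) e0 • e0)) (fsh * (Ψ 0 - l2 (Ψ 0) e0 • e0)) := by
    have h := (firstMoment_split (L := 1) e hon heig hdom hfηphys (winHi ((i : ℕ) + 1))).1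
    exact (Finset.sum_le_sum_of_subset_of_nonneg hSsub fun m _ _ => sq_nonneg _).trans h
  have hBesselΨ : ∑ m ∈ Ico (winLo ((i : ℕ) + 1)) (winHi ((i : ℕ) + 1)), l2 (Ψ jj) ((e m : physSubmodule 1) : Cfg → ℝ) ^ 2 ≤ l2 (Ψ jj) (Ψ jj) :=
    (Finset.sum_le_sum_of_subset_of_nonneg hSsub fun m _ _ => sq_nonneg _).trans hBesΨle
  -- the contamination is small
  have hsmall' : Cf * Real.sqrt (l2 (Ψ 0 - l2 (Ψ 0) e0 • e0) (Ψ 0 - l2 (Ψ 0) e0 • e0)) ≤ ϑ / 8 * Real.sqrt (l2 (Ψ jj) (Ψ jj)) := by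
    have h1 : Cf ^ 2 * l2 (Ψ 0 - l2 (Ψ 0) e0 • e0) (Ψ 0 - l2 (Ψ 0) e0 • e0) ≤ (ϑ / 8) ^ 2 * l2 (Ψ jj) (Ψ jj) :=
      (mul_le_mul_of_nonneg_left hηbound (sq_nonneg Cf)).trans (hηsmall i)
    have h2 := Real.sqrt_le_sqrt h1
    rwa [Real.sqrt_mul (sq_nonneg _), Real.sqrt_mul (sq_nonneg _), Real.sqrt_sq hCf0, Real.sqrt_sq (by linarith)] at h2
  -- transfer
  exact concentration_transfer (L := 1) he0 hn0 (hΨphys 0) (hΨphys jj) hfshphys hprod hfshCf hCf0 ha heS horthS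
    hBesselη hBesselΨ (hΨpos jj) hϑ0 hϑ1 hδ hinΨ hsmall'

end Summit.QuantumFields.YangMills.Theorems.FemtoTransferGap.PScal

end
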